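import Literature.AnabelianGeometry.AbsoluteAnabelian.AbsTopIII.AutHolLogFrobenius
import Literature.AnabelianGeometry.AbsoluteAnabelian.AbsTopIII.FrobeniusPictureMLFTelecoreCountermodel
import Literature.AnabelianGeometry.AbsoluteAnabelian.AbsTopIII.AutHolLogFrobeniusGaloisModel

/-!
# [AbsTopIII] Cor. 4.5 as typed (`Cor_4_5 Δ τ`): the universal closure of the schema — kernel verdict

S. Mochizuki, *Topics in Absolute Anabelian Geometry III*, §4, Corollary 4.5 pp. 107–110 (kurims
manuscript `paper:url-5493eb38cbb7`; bib key `MochizukiAbsTopIII2015`).  PROOF-ONLY companion of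
`AbsTopIII/AutHolLogFrobenius.lean` (abc-iut cell, F fact-proving wave, seat abc-iut-f-070, FACT-LIST
row F-0305 `Literature.AnabelianGeometry.AbsoluteAnabelian.AbsTopIII.Cor_4_5`); no notion is
declared, nothing is restated.

The row is a SCHEMA: `Cor_4_5 Δ τ := Δ.LogFrobeniusCompatible τ` is a predicate on ABSTRACT input data
`Δ : LogFrobeniusData` (six categories, functors, natural transformations) and first-row telecore data
`τ : Δ.TelecoreData` (cell ruling ν: the geometric instance "the data of Def. 4.1 arising from
elliptically admissible Aut-holomorphic orbispaces" is not constructed in the tree).  Kernel verdict on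
the row (FACT-LIST rule R5: a universal closure of a schema row is not a fact; instance forms are):

* `not_forall_cor_4_5` — the UNIVERSAL CLOSURE `∀ Δ τ, Cor_4_5 Δ τ` is FALSE: abc-iut-w5-d061's
  countermodel `exists_not_telecoreStmt` (one-object groupoid of `ℤ/2`, telecore identification twisted
  by the central element `g ≠ 1`) violates item (ii) (`Cor_4_5_ii Δ τ = Δ.TelecoreStmt τ`), hence
  `Cor_4_5` by `cor_4_5_iff`; `exists_not_cor_4_5` is the same as an explicit counterexample (with
  `id_⋎` fully faithful, so the failure is NOT an artefact of a degenerate nexus functor).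
* `exists_cor_4_5` — the schema is INHABITED at a non-toy instance already PROVED in the tree:
  abc-iut's `cor_4_5_arch_absoluteGaloisGroup_padic` (archimedean model over the Galois category of
  `Π = G_{ℚ_p}`, `p = 2`; file `AutHolLogFrobeniusGaloisModel.lean`), itself an instance of
  `cor_4_5_arch` / `cor_4_5_of_inputs` (Cor. 4.5 REDUCED to its printed model inputs: orientation
  `ι_× : λ^∼ → λ^×`, an object of `LinHol`, the Lemma-4.4 property, id-rigidity (Prop. 4.2 (i)),
  coherent `τ`).  Further instance forms in the tree, cited not restated: `cor_4_5_arch_TM`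
  (`ArchimedeanLogFrobeniusModelTM.lean`), the `HolFieldFunctorGeometric{,Disc,Plane,RC}` models,
  `LogFrobeniusToyWitness.lean`.
* `cor_4_5_schema_verdict` — both conjuncts in one statement, the form the FACT-LIST renderer's
  «universal-closure REFUTED; instance form PROVED» label describes.

HONEST FRAMING: a statement about the cell's own typing of a refereed pre-IUT corollary over abstract
data — the printed Cor. 4.5 concerns specific geometric data and is neither refuted nor proved here;
nothing here bears on [IUTchIII] Cor. 3.12 or takes a side; typed ≠ proved.
-/

namespace Literature.AnabelianGeometry.AbsoluteAnabelian.AbsTopIII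

open _root_.CategoryTheory

/-- **F-0305, universal closure REFUTED.**  `Cor_4_5` as typed does NOT hold for all abstract input
data: at abc-iut-w5-d061's twisted one-object-groupoid datum (`exists_not_telecoreStmt`) item (ii)
`TelecoreStmt` fails, hence so does `Cor_4_5 = LogFrobeniusCompatible` (`cor_4_5_iff`).  (FACT-LIST
F-0305; R5: the schema is consumed at named instances only.)
[cite: MochizukiAbsTopIII2015, Corollary 4.5 pp.107–109] -/
theorem not_forall_cor_4_5 :
    ¬ ∀ (Δ : LogFrobeniusData.{0}) (τ : Δ.TelecoreData),
      Literature.AnabelianGeometry.AbsoluteAnabelian.AbsTopIII.Cor_4_5 Δ τ := by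
  intro h
  obtain ⟨Δ, τ, -, hτ⟩ := exists_not_telecoreStmt
  exact hτ ((cor_4_5_iff Δ τ).mp (h Δ τ)).2.1

/-- **F-0305, explicit counterexample to the universal closure**: some abstract log-Frobenius datum
with FULLY FAITHFUL `id_⋎` and some first-row telecore datum violate `Cor_4_5` (through item (ii)).
[cite: MochizukiAbsTopIII2015, Corollary 4.5 (ii) p.108] -/
theorem exists_not_cor_4_5 :
    ∃ (Δ : LogFrobeniusData.{0}) (τ : Δ.TelecoreData), Nonempty Δ.toNexus.FullyFaithful ∧
      ¬ Literature.AnabelianGeometry.AbsoluteAnabelian.AbsTopIII.Cor_4_5 Δ τ := by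
  obtain ⟨Δ, τ, hν, hτ⟩ := exists_not_telecoreStmt
  exact ⟨Δ, τ, hν, fun h => hτ ((cor_4_5_iff Δ τ).mp h).2.1⟩

/-- **F-0305, instance form PROVED (cited)**: the schema `Cor_4_5` is inhabited at the archimedean
model over the Galois category of `Π = G_{ℚ_2}` — abc-iut's `cor_4_5_arch_absoluteGaloisGroup_padic`,
an instance of the reduction `cor_4_5_of_inputs` to the printed model inputs.
[cite: MochizukiAbsTopIII2015, Corollary 4.5 pp.107–109] -/
theorem exists_cor_4_5 :
    ∃ (Δ : LogFrobeniusData.{1}) (τ : Δ.TelecoreData),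
      Literature.AnabelianGeometry.AbsoluteAnabelian.AbsTopIII.Cor_4_5 Δ τ := by
  haveI : Fact (Nat.Prime 2) := ⟨Nat.prime_two⟩
  exact ⟨_, _, cor_4_5_arch_absoluteGaloisGroup_padic 2⟩

/-- **F-0305, kernel verdict on the schema row** `AbsTopIII.Cor_4_5`: its universal closure is
refuted AND it holds at a named instance proved in the tree — i.e. the row is a genuine hypothesis on
the input data, dischargeable instance by instance (`cor_4_5_of_inputs`), never as a closed fact.
[cite: MochizukiAbsTopIII2015, Corollary 4.5 pp.107–109] -/
theorem cor_4_5_schema_verdict :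
    (¬ ∀ (Δ : LogFrobeniusData.{0}) (τ : Δ.TelecoreData),
        Literature.AnabelianGeometry.AbsoluteAnabelian.AbsTopIII.Cor_4_5 Δ τ) ∧
      ∃ (Δ : LogFrobeniusData.{1}) (τ : Δ.TelecoreData),
        Literature.AnabelianGeometry.AbsoluteAnabelian.AbsTopIII.Cor_4_5 Δ τ :=
  ⟨not_forall_cor_4_5, exists_cor_4_5⟩

end Literature.AnabelianGeometry.AbsoluteAnabelian.AbsTopIII
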